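import Mathlib
import HarnessLib
import Summits.RiemannHypothesis.RiemannHypothesis.Theorems.EarlyAppointmentsRemainder0XiArtanhBound

/-!
# ⟨24730⟩ stub 3 — `stub_farLogKernelSharp`, REGISTERED TEXT, proved

Crux r3 `Remainder0Xi` (stmt-RiemannHypothesis-24730), line `Cruxes/Remainder0Xi/Lines/rho2_v2.lean`
(registry 50be66a6), stub l.78 `stub_farLogKernelSharp : FarLogKernelSharp` with the registered text
(l.72–74) `∀ γ : ℝ, T_PT < γ → ∀ x : ℝ, |x - γ| ≤ boxHalfWidth → |mainIntegral x| ≤ (eta0 - errorBudgetSShares) / xiSpacing γ`.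

(CA372)(1): the closing theorem states that text EXPLICITLY AND VERBATIM (never by the bare name, which
#1042 bound to the asymptotic form inside the crux-line namespace), with `T_PT`, `xiSpacing`, `boxHalfWidth`,
`eta0` = `…EarlyAppointmentsRemainder0XiEtaLedgerArith`'s, `mainIntegral` = #1042's, and `e1 … e5`,
`errorBudgetSShares` = the registered skeleton's own constants (l.36–41), restated below in the skeleton's
namespace with their bodies VERBATIM because the registry module cannot be co-imported with …EtaLedgerArith /
#1042 (every body is character-identical to the registry's; a desk scratch file certifies the registry `def`
is definitionally the statement below).
(CA372)(3) LANE RULE: all helper lemmas live under `…Theorems.EarlyAppointmentsRemainder0Xi.RegistryForm`;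
the crux-line namespace receives only the skeleton's constants and the by-name closing theorem.

Proof: `…ArtanhBound.farLogKernelSharp_asymptotic` (|MAIN(x) + π/4| ≤ 191·log x/x for x > T_PT/2) +
desk arithmetic (191·log x/x ≤ 1/1000 via log x ≤ 2√x; log(γ/2π) ≥ 26; π/4 + 1/1000 ≤ (1/2 − E)·26/(2π) for
E ≤ 0.09133).  Standard axioms only (`stub_etaLedgerArith`, whose closure carries a `native_decide` axiom, is NOT used).
Nothing here bears on the truth of RH; RH is not proved; 24730 OPEN.
-/

set_option linter.dupNamespace false

namespace Summit.RiemannHypothesis.RiemannHypothesis.Theorems.EarlyAppointmentsRemainder0Xi.RegistryForm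

open Real Set
open Summit.RiemannHypothesis.RiemannHypothesis.Cruxes.Remainder0Xi.Rho2V2

/-- The local spacing is positive above the Platt–Trudgian height. -/
theorem xiSpacing_pos {γ : ℝ} (hγ : T_PT < γ) : 0 < xiSpacing γ := by
  have h2pi : 0 < 2 * Real.pi := by positivity
  have hT : T_PT = 3000175332800 := rfl
  have hγ1 : 1 < γ / (2 * Real.pi) := by
    rw [one_lt_div h2pi]
    nlinarith [Real.pi_lt_four]
  unfold xiSpacing
  exact div_pos h2pi (Real.log_pos hγ1)

/-- A point of the box around `γ > T_PT` lies beyond `T_PT / 2`. -/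
theorem T_PT_half_lt_of_box {γ x : ℝ} (hγ : T_PT < γ) (hx : |x - γ| ≤ boxHalfWidth) :
    T_PT / 2 < x := by
  have h1 : γ - boxHalfWidth ≤ x := by have := (abs_le.1 hx).1; linarith
  have hT : T_PT = 3000175332800 := rfl
  have hB : boxHalfWidth = 135 / 2 := rfl
  rw [hT] at hγ ⊢
  rw [hB] at h1
  linarith

/-- The small term: `191 · log x / x ≤ 1/1000` for `x > T_PT / 2` (via `log x ≤ 2 √x`). -/
theorem smallTerm_le {x : ℝ} (hx : T_PT / 2 < x) :
    Real.log x * (135 + 4 * lowStart) / x ≤ 1 / 1000 := by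
  have hx0 : 0 < x := pos_of_T_PT_half_lt hx
  have hT : T_PT = 3000175332800 := rfl
  have hxL : (1500087666400 : ℝ) < x := by rw [hT] at hx; linarith
  have hs : 1200000 < Real.sqrt x := by
    rw [Real.lt_sqrt (by norm_num)]
    linarith
  have hlog : Real.log x ≤ 2 * Real.sqrt x := by
    have h := Real.log_le_rpow_div hx0.le (by norm_num : (0 : ℝ) < 1 / 2)
    rw [← Real.sqrt_eq_rpow] at h
    have : Real.sqrt x / (1 / 2) = 2 * Real.sqrt x := by ring
    linarith [h, this]
  have hsq : Real.sqrt x ^ 2 = x := Real.sq_sqrt hx0.le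
  have hL : lowStart = 14 := rfl
  rw [hL, div_le_iff₀ hx0]
  nlinarith [hlog, hs, hsq, Real.sqrt_nonneg x]

/-- The log at the Platt–Trudgian height: `26 ≤ log (γ / 2π)` for `γ > T_PT`. -/
theorem log_div_twoPi_ge {γ : ℝ} (hγ : T_PT < γ) : 26 ≤ Real.log (γ / (2 * Real.pi)) := by
  have h2pi : 0 < 2 * Real.pi := by positivity
  have hT : T_PT = 3000175332800 := rfl
  have hγpos : 0 < γ / (2 * Real.pi) := div_pos (by rw [hT] at hγ; linarith) h2pi
  rw [Real.le_log_iff_exp_le hγpos]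
  have h26 : Real.exp 26 = Real.exp 1 ^ 26 := by
    rw [← Real.exp_nat_mul]; norm_num
  have he : Real.exp 26 ≤ 2 * 10 ^ 11 := by
    rw [h26]
    have h1 : Real.exp 1 ≤ 2.72 := by linarith [Real.exp_one_lt_d9]
    calc Real.exp 1 ^ 26 ≤ (2.72 : ℝ) ^ 26 := by gcongr
      _ ≤ 2 * 10 ^ 11 := by norm_num
  have hγ' : 2 * 10 ^ 11 ≤ γ / (2 * Real.pi) := by
    rw [le_div_iff₀ h2pi]
    rw [hT] at hγ
    nlinarith [Real.pi_lt_four]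
  linarith

/-- The registry's right-hand side dominates `π/4 + 1/1000` for any budget `E ≤ 0.09133`. -/
theorem registryRhs_ge {γ E : ℝ} (hγ : T_PT < γ) (hE : E ≤ 9133 / 100000) :
    Real.pi / 4 + 1 / 1000 ≤ (eta0 - E) / xiSpacing γ := by
  have h2pi : 0 < 2 * Real.pi := by positivity
  have hL := log_div_twoPi_ge hγ
  have hLpos : 0 < Real.log (γ / (2 * Real.pi)) := by linarith
  have hE0 : eta0 = 1 / 2 := rfl
  rw [hE0]
  unfold xiSpacing
  rw [div_div_eq_mul_div, le_div_iff₀ h2pi]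
  nlinarith [Real.pi_lt_four, Real.pi_pos, hL]

/-- **Registry form from the asymptotic form**: for any budget `E ≤ 0.09133`,
`(∀ x > T_PT/2, |MAIN(x) + π/4| ≤ 191·log x/x) → ∀ γ > T_PT, ∀ x, |x − γ| ≤ 67.5 → |MAIN(x)| ≤ (η₀ − E)/s(γ)`. -/
theorem registry_of_asymptotic
    (h : Summit.RiemannHypothesis.RiemannHypothesis.Cruxes.Remainder0Xi.Rho2V2.FarLogKernelSharp)
    {E : ℝ} (hE : E ≤ 9133 / 100000) :
    ∀ γ : ℝ, T_PT < γ → ∀ x : ℝ, |x - γ| ≤ boxHalfWidth →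
      |mainIntegral x| ≤ (eta0 - E) / xiSpacing γ := by
  intro γ hγ x hx
  have hxT : T_PT / 2 < x := T_PT_half_lt_of_box hγ hx
  have hmain : |mainIntegral x + Real.pi / 4| ≤ Real.log x * (135 + 4 * lowStart) / x := h x hxT
  have hsmall := smallTerm_le hxT
  have hrhs := registryRhs_ge hγ hE
  have htri : |mainIntegral x| ≤ |mainIntegral x + Real.pi / 4| + Real.pi / 4 := by
    have h1 := abs_sub (mainIntegral x + Real.pi / 4) (Real.pi / 4)
    have hpi : |Real.pi / 4| = Real.pi / 4 := abs_of_pos (by positivity)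
    rw [add_sub_cancel_right, hpi] at h1
    exact h1
  linarith

/-- The registered text with the budget evaluated, for any `E ≤ 0.09133` (unconditional). -/
theorem farLogKernelSharp_registry_text {E : ℝ} (hE : E ≤ 9133 / 100000) :
    ∀ γ : ℝ, T_PT < γ → ∀ x : ℝ, |x - γ| ≤ boxHalfWidth →
      |mainIntegral x| ≤ (eta0 - E) / xiSpacing γ :=
  registry_of_asymptotic ArtanhBound.farLogKernelSharp_asymptotic hE

end Summit.RiemannHypothesis.RiemannHypothesis.Theorems.EarlyAppointmentsRemainder0Xi.RegistryForm

namespace Summit.RiemannHypothesis.RiemannHypothesis.Cruxes.Remainder0Xi.Rho2V2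

/-- Error budget term e1 (off-line far zeros). -/
noncomputable abbrev e1 : ℝ := 148 / 10000
/-- Error budget term e2 (complex w vs real x). -/
noncomputable abbrev e2 : ℝ := 148 / 10000
/-- Error budget term e3 (Lehman boundary). -/
noncomputable abbrev e3 : ℝ := 602 / 10000
/-- Error budget term e4 (Lehman integral). -/
noncomputable abbrev e4 : ℝ := 15 / 10000
/-- Error budget term e5 (crumbs). -/
noncomputable abbrev e5 : ℝ := 3 / 100000
/-- Total error budget in s-shares (registry l.36-41). -/
noncomputable abbrev errorBudgetSShares : ℝ := e1 + e2 + e3 + e4 + e5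

/-- **⟨24730⟩ stub 3, `stub_farLogKernelSharp`** — the REGISTERED TEXT of
`Cruxes/Remainder0Xi/Lines/rho2_v2.lean` l.72–74 (registry 50be66a6), stated verbatim ((CA372)(1)):
|MAIN(x)| ≤ (η₀ − E)/s(γ) for every `γ > T_PT` and every `x` with `|x − γ| ≤ 67.5`. -/
theorem stub_farLogKernelSharp :
    ∀ γ : ℝ, T_PT < γ → ∀ x : ℝ, |x - γ| ≤ boxHalfWidth →
      |mainIntegral x| ≤ (eta0 - errorBudgetSShares) / xiSpacing γ :=
  Summit.RiemannHypothesis.RiemannHypothesis.Theorems.EarlyAppointmentsRemainder0Xi.RegistryForm.farLogKernelSharp_registry_text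
    (E := errorBudgetSShares) (by norm_num [errorBudgetSShares, e1, e2, e3, e4, e5])

end Summit.RiemannHypothesis.RiemannHypothesis.Cruxes.Remainder0Xi.Rho2V2
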